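import Literature.AnabelianGeometry.AbsoluteAnabelian.AbsTopIII.ReconstructionCor110NatReciprocity
import Literature.AnabelianGeometry.AbsoluteAnabelian.AbsTopIII.ReconstructionCor110NatCyclotome
import Literature.AnabelianGeometry.AbsoluteAnabelian.AbsTopIII.ReconstructionCor110iiPrimeProofs
import Literature.AnabelianGeometry.AbsoluteAnabelian.AbsAnabUnitsTransportHolds
import HarnessLib

/-!
# [AbsTopIII] Cor. 1.10 (i)(b), NATURAL form — DISCHARGE of `AbsTopIII.Cor_1_10_i_b_natural`

Mochizuki, *Topics in Absolute Anabelian Geometry III*, Cor. 1.10 (i)(b) pp. 41–42 (manuscript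
pagination, lit key `paper:url-5493eb38cbb7`): «There exists a functorial "group-theoretic" algorithm for
reconstructing … the natural surjection `H¹(G_k, μ_Ẑ(G_k)) ⥲ G_k^ab ↠ Ẑ` … from the profinite group
`G_k`».  abc-iut-L4-d1 typed the isomorphism part of «functorial» as the named statement
`AbsTopIII.Cor_1_10_i_b_natural` (`ReconstructionCor110iiPrime.lean`, reading (N)): ONE family of additive
isomorphisms `j_k : H¹(G_k, μ_Ẑ(G_k)) ≃+ G_k^ab` over the MLFs `k : Type` (valued form), each
Kummer/reciprocity-compatible (reading (D)), with `j_{k₂} ∘ H¹(α; μ_Ẑ(α)) = α^ab ∘ j_{k₁}` for EVERY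
isomorphism of topological groups `α : G_{k₁} ≃ₜ* G_{k₂}`.  This file PROVES it
(`AbsTopIII.cor_1_10_i_b_natural_holds`); abc-iut cell, layer L4, row «Cor110ib-NAT» (abc-iut-L4-d3,
L4-lead RULINGS #5r (4) / #6c).

THE FAMILY.  For each `k`: `D_k` = the LCFT torsion reciprocity data CHARACTERISED by Serre's `θ`
(`exists_torsionReciprocityData_levelChar`, [AbsAnab] Prop. 1.2.1 (vi)), `i_k := galCyclotomeIsoTateModule k
D_k.equiv _` (abc-iut-L4-t11: `μ_Ẑ(G_k) ≅ Ẑ(1)(k̄)`), abc-iut-L4-t11's `H¹_cont(G_k, Ẑ(1)) ≃+ (kˣ)^∧`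
(`continuousCohomologyOneTateModuleEquivCompletion`, NSW II (2.7.5) + Kummer theory) and the completion
`e_k : (kˣ)^∧ ≃ₜ* G_k^ab` of the CANONICAL reciprocity map `θ_k` (`Cor110Nat.exists_completionEquiv_apply_eta_eq`);
`j_k := H¹(i_k) ≫ Kummer ≫ e_k` — literally the shape of abc-iut-L4-d1's
`Cor110iiPrime.reciprocityOfContainerIso_eq`, which gives clause (1) (`j_k ∘ H¹(φ)⁻¹ ∘ κ̂ = e_k ∘ η = θ_k`
is a local reciprocity map, `isLocalReciprocityMap_levelTheta`).

NATURALITY (clause (2)), transported along `α` and THE units transport `ψ̄_α : k̄₁ˣ ⥲ k̄₂ˣ` of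
[AbsAnab] Prop. 1.2.1 (vi) (abc-iut-L4-d3's `Prop121vii.unitsTransport_holds`):
(1) cyclotome square — `i_{k₂} ∘ μ_Ẑ(α) = Ẑ(1)(ψ̄_α) ∘ i_{k₁}` levelwise
(`Cor110Nat.muVal_tateCocycle_transport`, over abc-iut-L6-t11's `theta_transport_of_levelChar`);
(2)+(3) Kummer square — level `n`: a crossed homomorphism of `μ_n(k̄₂)` obtained by `ψ̄_α`-transport of one
in the Kummer class of `a ∈ k₁ˣ` lies in the Kummer class of `ψ̄_α(a) ∈ k₂ˣ`
(`oneCocycleClass_transport_eq_kummerMap`, explicit cocycles), read on the `(kᵢˣ)^∧`-coordinates of the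
`Ẑ(1)`-classes (`proj_kummerCompletion_eq`);
(4) reciprocity square — `e_{k₂} ∘ ψ̂_α = α^ab ∘ e_{k₁}` (`Cor110Nat.completionEquiv_unitsTransport`, from
abc-iut-L4-d3's `Prop121vii.levelwise_of_isAlphaEquivariant`).

Proof-only (theorems; no definitions, no named facts, no `sorry`); universe `0`.  HONEST FRAMING:
classical local class field theory and Kummer theory; [AbsTopIII]/[AbsAnab] are refereed papers; nothing
here bears on [IUTchIII] Cor. 3.12 or takes a side; typed ≠ proved.
-/

noncomputable section

open CategoryTheory Function
open Field IsNonarchimedeanLocalField ValuativeRel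
open ProfiniteGrp ProfiniteGrp.ProfiniteCompletion

namespace Literature.AnabelianGeometry.AbsoluteAnabelian

open _root_.TopRep _root_.ContRepresentation _root_.ContinuousCohomology
open Literature.NumberTheory.GaloisRepresentations
open Literature.NumberTheory.GaloisRepresentations.DiscreteGaloisModule
open Literature.NumberTheory.GaloisRepresentations.LocalWeilDatum

namespace Cor110Nat

/-! ### The Kummer square at level `n`, on explicit crossed homomorphisms -/

section KummerLevel

variable {K₁ K₂ : Type} [Field K₁] [CharZero K₁] [Field K₂] [CharZero K₂]

/-- **Level-`n` Kummer naturality under an `α`-equivariant `ψ̄`** ([AbsAnab] Prop. 1.2.1 (vii) proof,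
step N1 «the natural isomorphism … group-theoretic, by (iii)», in degree `1`; Serre, *Galois Cohomology*
II §1.2): if a continuous crossed homomorphism `c₁ : G_{k₁} → μ_n(k̄₁)` lies in the Kummer class of
`a ∈ k₁ˣ` and `c₂ : G_{k₂} → μ_n(k̄₂)` is its transport, `c₂(σ') = ψ̄ (c₁ (α⁻¹ σ'))`, then `c₂` lies in
the Kummer class of the element `b ∈ k₂ˣ` with `ψ̄(a) = b`: writing `c₁ = (σ ↦ σ r / r)` with `rⁿ = a`
(`oneCocycleClass_eq_zero_iff`), equivariance gives `c₂ = (σ' ↦ σ' (ψ̄ r) / ψ̄ r)` with `(ψ̄ r)ⁿ = b`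
(`kummerClassHom_eq_of_pow_eq`). [cite: MochizukiAbsAnab2004, Prop 1.2.1 (vii) p.11] -/
theorem oneCocycleClass_transport_eq_kummerMap (α : absoluteGaloisGroup K₁ ≃ₜ* absoluteGaloisGroup K₂)
    {ψ : (AlgebraicClosure K₁)ˣ ≃* (AlgebraicClosure K₂)ˣ} (hψ : Prop121vii.IsAlphaEquivariant α ψ)
    (n : ℕ+) {a : K₁ˣ} {b : K₂ˣ}
    (hab : ψ (Units.map (algebraMap K₁ (AlgebraicClosure K₁) : K₁ →* AlgebraicClosure K₁) a) =
      Units.map (algebraMap K₂ (AlgebraicClosure K₂) : K₂ →* AlgebraicClosure K₂) b)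
    (c₁ : contOneCocycles (mu K₁ n).toTopRep)
    (hc₁ : oneCocycleClass _ c₁ = Multiplicative.toAdd (kummerMap K₁ n a))
    (c₂ : contOneCocycles (mu K₂ n).toTopRep)
    (hc₂ : ∀ σ' : absoluteGaloisGroup K₂, muVal K₂ n (c₂.1 σ') = ψ (muVal K₁ n (c₁.1 (α.symm σ')))) :
    oneCocycleClass _ c₂ = Multiplicative.toAdd (kummerMap K₂ n b) := by
  -- `c₁ - (σ ↦ σ r / r) = ∂v`, `rⁿ = a`
  set r := kummerUnitsRoot K₁ n a with hr
  have h0 : oneCocycleClass _ (c₁ - kummerOneCocycle K₁ n r) = 0 := by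
    rw [oneCocycleClass_sub, hc₁, kummerMap_apply, kummerClassHom_apply, toAdd_ofAdd, sub_self]
  obtain ⟨v, hv⟩ := (oneCocycleClass_eq_zero_iff _ _).1 h0
  -- `r' := r · w`, `w := v ∈ μ_n`, has `c₁ σ = σ r' / r'` and `r'ⁿ = a`
  set w : (AlgebraicClosure K₁)ˣ := muVal K₁ n v with hw
  have hwn : w ^ (n : ℕ) = 1 := muVal_pow_eq_one K₁ n v
  have hc₁' : ∀ σ : absoluteGaloisGroup K₁,
      muVal K₁ n (c₁.1 σ) = σ • ((r : (AlgebraicClosure K₁)ˣ) * w) / ((r : (AlgebraicClosure K₁)ˣ) * w) := by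
    intro σ
    have h := hv σ
    have h' : c₁.1 σ = kummerOneCocycleFun K₁ n r σ + ((mu K₁ n).toTopRep.ρ σ v - v) := by
      rw [← h]
      change c₁.1 σ = (kummerOneCocycle K₁ n r).1 σ + (c₁.1 σ - (kummerOneCocycle K₁ n r).1 σ)
      abel
    rw [h', muVal_add, muVal_sub, muVal_kummerOneCocycleFun]
    change _ * (muVal K₁ n (mu K₁ n σ v) / w) = _
    rw [muVal_apply, smul_mul', mul_div_mul_comm]
  -- the transported root `s := ψ̄ (r w)` and its `n`-th power
  set s : (AlgebraicClosure K₂)ˣ := ψ ((r : (AlgebraicClosure K₁)ˣ) * w) with hs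
  have hsn : s ^ (n : ℕ) = Units.map (algebraMap K₂ (AlgebraicClosure K₂) : K₂ →* AlgebraicClosure K₂) b := by
    rw [hs, ← map_pow, mul_pow, hwn, mul_one, hr, kummerUnitsRoot_pow, hab]
  have hsK : s ∈ kummerUnits K₂ n := by
    intro σ'
    rw [hsn]
    exact Prop121vii.smul_unitsMap_algebraMap K₂ b σ'
  -- `c₂ = (σ' ↦ σ' s / s)`
  have hc₂' : c₂ = kummerOneCocycle K₂ n ⟨s, hsK⟩ := by
    refine Subtype.ext (ContinuousMap.ext fun σ' => muVal_injective K₂ n ?_)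
    rw [hc₂ σ', hc₁', kummerOneCocycle_apply, muVal_kummerOneCocycleFun, map_div, hψ,
      ContinuousMulEquiv.apply_symm_apply]
  have hcl : kummerClassHom K₂ n ⟨s, hsK⟩ = kummerClassHom K₂ n (kummerUnitsRoot K₂ n b) :=
    kummerClassHom_eq_of_pow_eq K₂ n (by rw [kummerUnitsRoot_pow]; exact hsn)
  rw [hc₂', kummerMap_apply, ← hcl, kummerClassHom_apply, toAdd_ofAdd]

end KummerLevel

/-! ### Kummer coordinates of `H¹_cont(G_k, Ẑ(1)) ≃ (kˣ)^∧` and of a completed homomorphism -/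

section Coordinates

variable (K : Type) [Field K] [CharZero K]
  (hfin : ∀ n : ℕ+, ((powMonoidHom (n : ℕ) : Kˣ →* Kˣ).range).FiniteIndex)

/-- **Kummer coordinates of abc-iut-L4-t11's `H¹_cont(G_k, Ẑ(1)) ≃+ (kˣ)^∧`**: the `kˣ/(kˣ)ⁿ`-component of
the image of a class `Y`, read through the Kummer isomorphism `kˣ/(kˣ)ⁿ ⥲ H¹(G_k, μ_n)`, is the image of
`Y` in `H¹(G_k, μ_n)` (Serre, *Galois Cohomology* II §1.2; the defining coordinates of
`continuousCohomologyOneTateModuleEquivCompletion`). [cite: SerreGaloisCohomology1997, II §1.2] -/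
theorem kummerLift_proj_equivCompletion (Y : continuousCohomology 1 (tateModuleMu K).toTopRep) (n : ℕ+) :
    kummerLift K n (PowCompletion.proj hfin n
      (Additive.toMul (continuousCohomologyOneTateModuleEquivCompletion K hfin Y))) =
      Multiplicative.ofAdd (cohomologyMap ((muSystem K).projHom n) 1 Y) := by
  set x := Additive.toMul (continuousCohomologyOneTateModuleEquivCompletion K hfin Y) with hx
  have h1 : completionUnitsEquivCohomologyLimitMu K hfin x =
      Multiplicative.ofAdd (continuousCohomologyOneTateModuleEquiv K Y) := by
    rw [hx]
    change completionUnitsEquivCohomologyLimitMu K hfin ((completionUnitsEquivCohomologyLimitMu K hfin).symm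
      (Multiplicative.ofAdd (continuousCohomologyOneTateModuleEquiv K Y))) = _
    exact MulEquiv.apply_symm_apply _ _
  have h2 := congrArg (fun z : Multiplicative ((muSystem K).cohomologyLimit 1) =>
    ((Multiplicative.toAdd z : (muSystem K).cohomologyLimit 1) :
      ∀ n, continuousCohomology 1 ((muSystem K).ρ n).toTopRep) n) h1
  simp only at h2
  rw [toAdd_ofAdd] at h2
  change ((Multiplicative.toAdd (completionUnitsToCohomologyLimit K hfin x) :
      (muSystem K).cohomologyLimit 1) : ∀ n, continuousCohomology 1 ((muSystem K).ρ n).toTopRep) n = _ at h2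
  rw [completionUnitsToCohomologyLimit_apply, continuousCohomologyOneTateModuleEquiv,
    DiscreteInvSystem.coe_continuousCohomologyOneLimitEquiv_apply] at h2
  rw [← ofAdd_toAdd (kummerLift K n _), h2]

variable {A B : Type} [CommGroup A] [CommGroup B]
  (hA : ∀ n : ℕ+, ((powMonoidHom (n : ℕ) : A →* A).range).FiniteIndex)
  (hB : ∀ n : ℕ+, ((powMonoidHom (n : ℕ) : B →* B).range).FiniteIndex)

omit hfin in
/-- `f(Aⁿ) ⊆ Bⁿ` for a homomorphism `f : A → B`. [cite: RibesZalesskii2010, Thm 2.7.1] -/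
theorem range_pow_le_comap (f : A →* B) (n : ℕ) :
    (powMonoidHom n : A →* A).range ≤ ((powMonoidHom n : B →* B).range).comap f := by
  rintro _ ⟨a, rfl⟩
  exact ⟨f a, by rw [powMonoidHom_apply, powMonoidHom_apply, map_pow]⟩

omit hfin in
/-- **Power coordinates of a completed homomorphism**: a continuous homomorphism `Ψ : Â → B̂` of
profinite completions extending `f : A → B` (`Ψ ∘ η = η ∘ f`) acts on the `A/Aⁿ`-components through
`f` — both sides are continuous into the finite level and agree on the dense image of `η`.
[cite: RibesZalesskii2010, Thm 2.7.1] -/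
theorem proj_completionHom_eq (f : A →* B)
    {Ψ : completion (GrpCat.of A) →ₜ* completion (GrpCat.of B)}
    (hΨ : ∀ a : A, Ψ (etaFn (GrpCat.of A) a) = etaFn (GrpCat.of B) (f a))
    (n : ℕ+) (x : completion (GrpCat.of A)) :
    PowCompletion.proj hB n (Ψ x) =
      QuotientGroup.map _ _ f (range_pow_le_comap f n) (PowCompletion.proj hA n x) := by
  haveI : DiscreteTopology ((diagram (GrpCat.of A)).obj (PowCompletion.powLevel hA n)) := ⟨rfl⟩
  haveI : DiscreteTopology ((diagram (GrpCat.of B)).obj (PowCompletion.powLevel hB n)) := ⟨rfl⟩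
  have hcA : Continuous (fun c : completion (GrpCat.of A) =>
      (c.1 (PowCompletion.powLevel hA n) : (diagram (GrpCat.of A)).obj (PowCompletion.powLevel hA n))) :=
    ((ProfiniteGrp.limitCone (diagram (GrpCat.of A))).π.app (PowCompletion.powLevel hA n)).hom.continuous_toFun
  have hcB : Continuous (fun c : completion (GrpCat.of B) =>
      (c.1 (PowCompletion.powLevel hB n) : (diagram (GrpCat.of B)).obj (PowCompletion.powLevel hB n))) :=
    ((ProfiniteGrp.limitCone (diagram (GrpCat.of B))).π.app (PowCompletion.powLevel hB n)).hom.continuous_toFun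
  have key : (fun x : completion (GrpCat.of A) =>
        ((Ψ x).1 (PowCompletion.powLevel hB n) : (diagram (GrpCat.of B)).obj (PowCompletion.powLevel hB n))) =
      fun x => (QuotientGroup.map _ _ f (range_pow_le_comap f n)
        (x.1 (PowCompletion.powLevel hA n)) : (diagram (GrpCat.of B)).obj (PowCompletion.powLevel hB n)) := by
    refine (denseRange (GrpCat.of A)).equalizer (hcB.comp Ψ.continuous)
      (continuous_of_discreteTopology.comp hcA) ?_
    funext a
    change ((Ψ (etaFn (GrpCat.of A) a)).1 (PowCompletion.powLevel hB n) : _) = _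
    rw [hΨ]
    rfl
  exact congrFun key x

end Coordinates

/-! ### The components of the family: LCFT cyclotome data and canonical completed reciprocity isos -/

section Components

/-- **The data of the natural family** (one choice PER FIELD, uniform in all `α`): for every MLF `k`
(valued form) torsion reciprocity data `D_k` ([AbsAnab] Prop. 1.2.1 (vi), the LCFT ones characterised by
Serre's `θ`, `exists_torsionReciprocityData_levelChar`) and a completed reciprocity isomorphism
`e_k : (kˣ)^∧ ≃ₜ* G_k^ab` through the CANONICAL reciprocity map (`Cor110Nat.exists_completionEquiv_apply_eta_eq`,
`isLocalReciprocityMap_levelTheta`) such that (o) `D_k` IS that chosen datum and `e_k ∘ η = θ_k` is the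
canonical reciprocity map (for consumers: abc-iut-L4-t11's open-injection square), (i) `e_k ∘ η` is a local
reciprocity map, and (ii) for
EVERY `α : G_{k₁} ≃ₜ* G_{k₂}` and every `α`-equivariant uniformiser-preserving `ψ̄` (THE units transport):
the cyclotome data are transported (`D_{k₂}.muLift ∘ μ_{ℚ/ℤ}(α) = ψ̄ ∘ D_{k₁}.muLift`, abc-iut-L6-t11's
`theta_transport_of_levelChar`) and the completed reciprocity isomorphisms satisfy
`e_{k₂} ∘ Ψ = α^{ab} ∘ e_{k₁}` for every continuous `Ψ` extending `ψ̄|_{k₁ˣ}`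
(`Cor110Nat.completionEquiv_unitsTransport`). [cite: MochizukiAbsTopIII2015, Cor 1.10 (i) p.42] -/
theorem exists_family_components :
    ∃ (D : ∀ (k : Type) [Field k] [ValuativeRel k] [TopologicalSpace k] [IsNonarchimedeanLocalField k]
        [CharZero k], TorsionReciprocityData k)
      (e : ∀ (k : Type) [Field k] [ValuativeRel k] [TopologicalSpace k] [IsNonarchimedeanLocalField k]
        [CharZero k], completion (GrpCat.of kˣ) ≃ₜ* absoluteGaloisGroupAbelianization k),
      (∀ (k : Type) [Field k] [ValuativeRel k] [TopologicalSpace k] [IsNonarchimedeanLocalField k]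
        [CharZero k], D k = (exists_torsionReciprocityData_levelChar k).choose) ∧
      (∀ (k : Type) [Field k] [ValuativeRel k] [TopologicalSpace k] [IsNonarchimedeanLocalField k]
        [CharZero k] [ValuativeExtension k k] (u : kˣ),
        e k (etaFn (GrpCat.of kˣ) u) =
          (isReciprocitySystemE (F := k) (E := k) (isClassFieldTheory_localWeilDatum k)).theta u) ∧
      (∀ (k : Type) [Field k] [ValuativeRel k] [TopologicalSpace k] [IsNonarchimedeanLocalField k]
        [CharZero k],
        IsLocalReciprocityMap k (((e k).toMulEquiv.toMonoidHom).comp (eta (GrpCat.of kˣ)).hom)) ∧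
      ∀ (k₁ : Type) [Field k₁] [ValuativeRel k₁] [TopologicalSpace k₁] [IsNonarchimedeanLocalField k₁]
        [CharZero k₁] (k₂ : Type) [Field k₂] [ValuativeRel k₂] [TopologicalSpace k₂]
        [IsNonarchimedeanLocalField k₂] [CharZero k₂]
        (α : absoluteGaloisGroup k₁ ≃ₜ* absoluteGaloisGroup k₂)
        (ψ : (AlgebraicClosure k₁)ˣ ≃* (AlgebraicClosure k₂)ˣ),
        Prop121vii.IsAlphaEquivariant α ψ → Prop121vii.PreservesUniformizers ψ →
        (∀ z : muQZ (absoluteGaloisGroup k₁),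
          Additive.toMul ((D k₂).muLift (muQZ.map α z)) = ψ (Additive.toMul ((D k₁).muLift z))) ∧
        ∀ {f : k₁ˣ →* k₂ˣ},
          (∀ u : k₁ˣ, Units.map (algebraMap k₂ (AlgebraicClosure k₂) : k₂ →* AlgebraicClosure k₂) (f u) =
            ψ (Units.map (algebraMap k₁ (AlgebraicClosure k₁) : k₁ →* AlgebraicClosure k₁) u)) →
          ∀ {Ψ : completion (GrpCat.of k₁ˣ) →ₜ* completion (GrpCat.of k₂ˣ)},
            (∀ u : k₁ˣ, Ψ (etaFn (GrpCat.of k₁ˣ) u) = etaFn (GrpCat.of k₂ˣ) (f u)) →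
            ∀ x : completion (GrpCat.of k₁ˣ), e k₂ (Ψ x) = abelianizationCongr α (e k₁ x) := by
  classical
  -- the canonical reciprocity map is a local reciprocity map (trivial level `E = k`)
  have hθ : ∀ (k : Type) [Field k] [ValuativeRel k] [TopologicalSpace k] [IsNonarchimedeanLocalField k]
      [CharZero k],
      IsLocalReciprocityMap k
        (@IsReciprocitySystem.theta k _ _ _ _ _
          (@isReciprocitySystemE k k _ _ _ _ _ _ _ _ _ _ _ ⟨fun _ _ => Iff.rfl⟩
            (isClassFieldTheory_localWeilDatum k))) := by
    intro k _ _ _ _ _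
    haveI : ValuativeExtension k k := ⟨fun _ _ => Iff.rfl⟩
    exact isLocalReciprocityMap_levelTheta
  refine ⟨fun k _ _ _ _ _ => (exists_torsionReciprocityData_levelChar k).choose,
    fun k _ _ _ _ _ => (exists_completionEquiv_apply_eta_eq k (hθ k)).choose, fun k _ _ _ _ _ => rfl,
    fun k _ _ _ _ _ _ u => ?_, fun k _ _ _ _ _ => ?_,
    fun k₁ _ _ _ _ _ k₂ _ _ _ _ _ α ψ hψ hU => ⟨fun z => ?_, fun {f} hf {Ψ} hΨ x => ?_⟩⟩
  · exact (exists_completionEquiv_apply_eta_eq k (hθ k)).choose_spec u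
  · have he := (exists_completionEquiv_apply_eta_eq k (hθ k)).choose_spec
    have hcomp : ((exists_completionEquiv_apply_eta_eq k (hθ k)).choose.toMulEquiv.toMonoidHom).comp
        (eta (GrpCat.of kˣ)).hom = _ := MonoidHom.ext fun u => he u
    rw [hcomp]
    exact hθ k
  · exact TorsionReciprocityData.toMul_muLift_map_of_level _ _ α ψ
      (fun U x => TorsionReciprocityData.theta_transport_of_levelChar
        (exists_torsionReciprocityData_levelChar k₁).choose_spec
        (exists_torsionReciprocityData_levelChar k₂).choose_spec hψ hU U x) z
  · haveI : ValuativeExtension k₁ k₁ := ⟨fun _ _ => Iff.rfl⟩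
    haveI : ValuativeExtension k₂ k₂ := ⟨fun _ _ => Iff.rfl⟩
    exact completionEquiv_unitsTransport α hψ hU hf hΨ
      (exists_completionEquiv_apply_eta_eq k₁ (hθ k₁)).choose_spec
      (exists_completionEquiv_apply_eta_eq k₂ (hθ k₂)).choose_spec x

end Components

/-! ### Transport of a completed homomorphism along `η` -/

section Lift

variable {A B : Type} [CommGroup A] [CommGroup B]

/-- The completion `Ψ := lift (f ≫ η) : Â → B̂` of a homomorphism `f : A → B` extends `f`:
`Ψ (η a) = η (f a)` (Mathlib `ProfiniteCompletion.lift_eta`). [cite: RibesZalesskii2010, Thm 2.7.1] -/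
theorem lift_comp_eta_apply (f : A →* B) (a : A) :
    (ProfiniteGrp.ProfiniteCompletion.lift (GrpCat.ofHom f ≫ eta (GrpCat.of B))).hom
        (etaFn (GrpCat.of A) a) = etaFn (GrpCat.of B) (f a) := by
  exact ConcreteCategory.congr_hom
    (ProfiniteGrp.ProfiniteCompletion.lift_eta (GrpCat.ofHom f ≫ eta (GrpCat.of B))) a

end Lift

end Cor110Nat

/-! ### The closer -/

open Cor110Nat in
/-- **[AbsTopIII] Cor. 1.10 (i)(b), NATURAL form — DISCHARGED** (`AbsTopIII.Cor_1_10_i_b_natural`,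
abc-iut-L4-d1's reading (N) of «a functorial "group-theoretic" algorithm for reconstructing …
`H¹(G_k, μ_Ẑ(G_k)) ⥲ G_k^ab`», p. 42): there is ONE family `j_k : H¹(G_k, μ_Ẑ(G_k)) ≃+ G_k^ab` over the
MLFs `k : Type` — `j_k := H¹(i_k) ≫ (H¹(G_k, Ẑ(1)) ≃ (kˣ)^∧) ≫ e_k` with `i_k` the LCFT identification
`μ_Ẑ(G_k) ≅ Ẑ(1)(k̄)` characterised by Serre's `θ` and `e_k` the completion of the CANONICAL reciprocity map —
such that (1) every `j_k ∘ H¹(φ_k)⁻¹ ∘ κ̂` is a local reciprocity map (it is `e_k ∘ η = θ_k`, abc-iut-L4-d1's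
`Cor110iiPrime.reciprocityOfContainerIso_eq`) and (2) `j_{k₂} ∘ H¹(α; μ_Ẑ(α)) = α^{ab} ∘ j_{k₁}` for EVERY
isomorphism of topological groups `α : G_{k₁} ≃ₜ* G_{k₂}`: transport along `α` and THE units transport
`ψ̄_α` of [AbsAnab] Prop. 1.2.1 (vi) (abc-iut-L4-d3 `Prop121vii.unitsTransport_holds`) through the cyclotome
square (abc-iut-L6-t11), the Kummer square at every finite level, and the reciprocity square
(`Prop121vii.levelwise_of_isAlphaEquivariant`), glued on the `(kᵢˣ)^∧`-coordinates
(`PowCompletion.ext_of_proj`). [cite: MochizukiAbsTopIII2015, Cor 1.10 (i) p.42] -/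
theorem AbsTopIII.cor_1_10_i_b_natural_holds :
    Literature.AnabelianGeometry.AbsoluteAnabelian.AbsTopIII.Cor_1_10_i_b_natural := by
  classical
  obtain ⟨D, e, -, -, hrec, hnat⟩ := exists_family_components
  refine ⟨fun k _ _ _ _ _ =>
    ((AddEquiv.mk' (continuousCohomologyEquivOfIso
          (galCyclotomeIsoTateModule k (D k).equiv (D k).equiv_smul) 1)
        fun x y => map_add (cohomologyMap (galCyclotomeIsoTateModule k (D k).equiv (D k).equiv_smul).hom 1).hom
          x y).trans
      (continuousCohomologyOneTateModuleEquivCompletion k (Cor110iiPrime.finiteIndex_range_powMonoidHom k))).trans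
      (MulEquiv.toAdditive (e k).toMulEquiv), fun k _ _ _ _ _ => ?_, fun k₁ _ _ _ _ _ k₂ _ _ _ _ _ α x => ?_⟩
  · -- clause (1): reading (D) for the member `j_k`, with `φ := (D k).equiv`
    refine ⟨(D k).equiv, (D k).equiv_smul, ?_⟩
    rw [Cor110iiPrime.reciprocityOfContainerIso_eq k (Cor110iiPrime.finiteIndex_range_powMonoidHom k)
      (D k).equiv (D k).equiv_smul (e k)]
    exact hrec k
  · -- clause (2): naturality
    -- THE units transport along `α` and its restriction `f : k₁ˣ ≃* k₂ˣ`, completed to `Ψ`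
    obtain ⟨ψ, hψ, -, hU⟩ := Prop121vii.unitsTransport_holds k₁ k₂ α
    obtain ⟨f₀, hf₀⟩ := hψ.exists_unitsMulEquiv
    set f : k₁ˣ →* k₂ˣ := f₀.toMonoidHom with hfdef
    have hf : ∀ u : k₁ˣ, Units.map (algebraMap k₂ (AlgebraicClosure k₂) : k₂ →* AlgebraicClosure k₂) (f u) =
        ψ (Units.map (algebraMap k₁ (AlgebraicClosure k₁) : k₁ →* AlgebraicClosure k₁) u) := fun u => hf₀ u
    set Ψ : completion (GrpCat.of k₁ˣ) →ₜ* completion (GrpCat.of k₂ˣ) :=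
      (ProfiniteGrp.ProfiniteCompletion.lift (GrpCat.ofHom f ≫ eta (GrpCat.of k₂ˣ))).hom with hΨdef
    have hΨ : ∀ u : k₁ˣ, Ψ (etaFn (GrpCat.of k₁ˣ) u) = etaFn (GrpCat.of k₂ˣ) (f u) := fun u =>
      lift_comp_eta_apply f u
    obtain ⟨hμ, hsq⟩ := hnat k₁ k₂ α ψ hψ hU
    -- abbreviations
    set hfin₁ := Cor110iiPrime.finiteIndex_range_powMonoidHom k₁
    set hfin₂ := Cor110iiPrime.finiteIndex_range_powMonoidHom k₂
    set i₁ := galCyclotomeIsoTateModule k₁ (D k₁).equiv (D k₁).equiv_smul with hi₁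
    set i₂ := galCyclotomeIsoTateModule k₂ (D k₂).equiv (D k₂).equiv_smul with hi₂
    -- the class `x = [c]` and its transports
    obtain ⟨c, rfl⟩ := oneCocycleClass_surjective _ x
    set c' := contOneCocycles.pullback (α.symm : absoluteGaloisGroup k₂ →ₜ* absoluteGaloisGroup k₁)
      (galCyclotomeResHom α) c with hc'
    set d₁ := contOneCocycles.pullback (ContinuousMonoidHom.id (absoluteGaloisGroup k₁)) (resIdHom i₁.hom) c
      with hd₁
    set d₂ := contOneCocycles.pullback (ContinuousMonoidHom.id (absoluteGaloisGroup k₂)) (resIdHom i₂.hom) c'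
      with hd₂
    -- unfold the two members of the family on the classes
    change Additive.ofMul (e k₂ (Additive.toMul (continuousCohomologyOneTateModuleEquivCompletion k₂ hfin₂
        ((cohomologyMap i₂.hom 1).hom (galCyclotomeH1Map α (oneCocycleClass _ c)))))) =
      Additive.ofMul (abelianizationCongr α (e k₁ (Additive.toMul
        (continuousCohomologyOneTateModuleEquivCompletion k₁ hfin₁ ((cohomologyMap i₁.hom 1).hom
          (oneCocycleClass _ c))))))
    rw [galCyclotomeH1Map_oneCocycleClass, ← hc']
    have e₂cl : (cohomologyMap i₂.hom 1).hom (oneCocycleClass _ c') = oneCocycleClass _ d₂ :=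
      cohomologyMap_oneCocycleClass i₂.hom c'
    have e₁cl : (cohomologyMap i₁.hom 1).hom (oneCocycleClass _ c) = oneCocycleClass _ d₁ :=
      cohomologyMap_oneCocycleClass i₁.hom c
    rw [e₂cl, e₁cl]
    set y := Additive.toMul (continuousCohomologyOneTateModuleEquivCompletion k₁ hfin₁ (oneCocycleClass _ d₁))
      with hy
    rw [← hsq hf hΨ y]
    congr 2
    -- the `(k₂ˣ)^∧`-coordinates agree: Kummer square at every level `n`
    refine PowCompletion.ext_of_proj hfin₂ fun n => ?_
    rw [proj_completionHom_eq hfin₁ hfin₂ f hΨ n y]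
    obtain ⟨a, ha⟩ := QuotientGroup.mk_surjective (PowCompletion.proj hfin₁ n y)
    rw [← ha]
    change _ = QuotientGroup.mk (f a)
    apply (kummerLift_bijective k₂ n).1
    rw [kummerLift_proj_equivCompletion k₂ hfin₂, kummerLift_mk,
      DiscreteInvSystem.cohomologyMap_projHom_oneCocycleClass]
    -- level `n`: `[proj_n d₁] = δ_n(a)`
    have h₁ : oneCocycleClass _ ((muSystem k₁).projCocycle₁ n d₁) =
        Multiplicative.toAdd (kummerMap k₁ n a) := by
      have h := kummerLift_proj_equivCompletion k₁ hfin₁ (oneCocycleClass _ d₁) n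
      rw [← hy, ← ha, kummerLift_mk, DiscreteInvSystem.cohomologyMap_projHom_oneCocycleClass] at h
      rw [h, toAdd_ofAdd]
    -- the transported Tate cocycles are `ψ̄`-related levelwise (cyclotome square)
    have h₂ : ∀ σ' : absoluteGaloisGroup k₂,
        muVal k₂ n (((muSystem k₂).projCocycle₁ n d₂).1 σ') =
          ψ (muVal k₁ n (((muSystem k₁).projCocycle₁ n d₁).1 (α.symm σ'))) := fun σ' => by
      rw [DiscreteInvSystem.projCocycle₁_apply, DiscreteInvSystem.projCocycle₁_apply, hd₂, hd₁, hc']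
      exact muVal_tateCocycle_transport (D k₁) (D k₂) α ψ hμ c σ' n
    rw [oneCocycleClass_transport_eq_kummerMap α hψ n (hf a).symm ((muSystem k₁).projCocycle₁ n d₁) h₁
      ((muSystem k₂).projCocycle₁ n d₂) h₂, ofAdd_toAdd]

/-- `Literature.AnabelianGeometry.AbsoluteAnabelian.AbsTopIII.Cor_1_10_i_b_natural` —
`_holds` alias of `AbsTopIII.cor_1_10_i_b_natural_holds` above (appended
2026-08-28, D-0026 bookkeeping: the proof term is the existing theorem of this file; no
statement, definition or attribute is edited; no new named fact).
[cite: MochizukiAbsTopIII2015, Cor 1.10 (i) p.42] -/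
theorem _root_.Literature.AnabelianGeometry.AbsoluteAnabelian.AbsTopIII.Cor_1_10_i_b_natural_holds :
    Literature.AnabelianGeometry.AbsoluteAnabelian.AbsTopIII.Cor_1_10_i_b_natural :=
  AbsTopIII.cor_1_10_i_b_natural_holds

end Literature.AnabelianGeometry.AbsoluteAnabelian
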